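import Mathlib.Probability.Moments.Variance
import Mathlib.Probability.Independence.Basic
import Mathlib.Analysis.SpecialFunctions.Exp
import Literature.Probability.ImportanceSampling.LogNormalWeights
import HarnessLib

/-!
# Annealed importance sampling under perfect transitions: the log-weight is a sum of independent
# terms, `Var(log w) = Σ_j (β_{j-1} - β_j)² Var_{p_j}(h)`, the equal-spacing `σ₀²/n` law, and the
# optimal number of distributions `n = σ₀²` (Neal 2001, §4)

Topic `Probability/ImportanceSampling`; namespace `Literature.Probability.ImportanceSampling`, grouped
under `AIS` (the sub-namespace of `AnnealedImportanceSampling.lean`, whose §2 identity `E[w] = Z_K/Z_0`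
this file complements with the §4 DISPERSION law). Everything is PROVED (Mathlib's variance of a
finite sum of pairwise independent random variables, `exp x ≥ 1 + x`, and the log-normal algebra of
`LogNormalWeights.lean`); no named fact, no axiom.

Source, VERBATIM [cite: Neal2001AIS, §4] (R. M. Neal, *Annealed importance sampling*, Statistics and
Computing 11 (2001) 125–139 = arXiv:physics/9803008, §4 "Efficiency of annealed importance
sampling"; held text `paper:arxiv-physics_9803008` p0007:L27–L76; the family of eq. (eq-family),
p0004:L19, is `f_j(x) = f_0(x)^{β_j} f_n(x)^{1-β_j}`, `1 = β_0 > β_1 > … > β_n = 0`):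
"For this analysis, we will assume that each `T_j` produces a state drawn from `p_j`, independent of
the previous state. … we see that if the `log(w^{(i)})` are Gaussian with mean `μ` and variance
`σ²`, the sample size will be effectively reduced by the factor
`1 + Var_g[w^{(i)}/E_g(w^{(i)})] = E[(w^{(i)})²]/E[w^{(i)}]² = exp(2μ+4σ²/2)/[exp(μ+σ²/2)]² = exp(σ²)`.
From equation (eq-aisw), `log(w^{(i)}) = Σ_{j=1}^n [log(f_{j-1}(x_{j-1})) - log(f_j(x_{j-1}))]`. If
the distributions used are as defined by equation (eq-family),
`log(w^{(i)}) = Σ_{j=1}^n (β_{j-1} - β_j) [log(f_0(x_{j-1})) - log(f_n(x_{j-1}))]`. If we further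
assume that the `β_j` are equally spaced (between 0 and 1), we have
`log(w^{(i)}) = (1/n) Σ_{j=1}^n [log(f_0(x_{j-1})) - log(f_n(x_{j-1}))]`. Under the assumption that
`T_j` produces a state drawn independently from `p_j`, and provided that
`log(f_0(x_{j-1})) - log(f_n(x_{j-1}))` has finite variance (when `x_{j-1}` is drawn from `p_j`), the
Central Limit Theorem can be applied to conclude that `log(w^{(i)})` will have an approximately
Gaussian distribution for large `n` … The variance of `log(w^{(i)})` will asymptotically have the
form `σ₀²/n`, for some constant `σ₀²`, and one plus the variance of the normalized weights will have
the form `exp(σ₀²/n)`. If we assume that each transition, `T_j`, takes a fixed amount of time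
(regardless of `n`), the time required to produce an estimate of a given degree of accuracy will be
proportional to `n exp(σ₀²/n)`, which is minimized when `n = σ₀²`, at which point the variance of the
logs of the importance weights will be one and the variance of the normalized importance weights
will be `e - 1`."

WHAT IS TYPED (the exact finite-`n` content of the passage; the CLT sentence is NOT typed):
* Setting. `(Ω, P)` a probability space; `X : Fin n → Ω → S` the `n` states at which the weight is
  updated (`X j` = Neal's `x_{j-1}` in his backward indexing, whose law is `p_j`); `h : S → ℝ`
  (`= log f_0 - log f_n`); coefficients `c : Fin n → ℝ` (`c j = β_{j-1} - β_j`). "Each `T_j`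
  produces a state drawn from `p_j`, independent of the previous state" (PERFECT TRANSITIONS) is
  typed as: the family `X` is mutually independent (`iIndepFun X P`) with marginal laws
  `P.map (X j) = p j`.
* `AIS.logWeight c h X` — `ω ↦ Σ_j c_j · h(X_j ω)` (Neal's displayed formula for `log w`).
* **`AIS.variance_logWeight`** — under independence, `Var[log w] = Σ_j c_j² · Var[h ∘ X_j]`;
  **`AIS.variance_logWeight_eq_sum_laws`** — `= Σ_j (β_{j-1} - β_j)² · Var_{p_j}[h]` in terms of the
  annealing laws (Neal's eq. (eq-aisvar) in exact form: the log-weight variance is the sum of the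
  per-step variances — the statement his last paragraph refers to, "the terms in equation
  (eq-aisvar) will no longer be independent", when the transitions are imperfect).
* **`AIS.variance_logWeight_equalSpacing`** — with `c j = 1/n`: `Var[log w] = (1/n) · σ₀²(n)` where
  `σ₀²(n) := (1/n) Σ_j Var_{p_j}[h]` is the MEAN per-step variance (Neal's "`σ₀²/n`" with the
  constant made explicit at finite `n`); **`AIS.variance_logWeight_le_div`** — if every
  `Var_{p_j}[h] ≤ V` then `Var[log w] ≤ V/n` (the `1/n` law as an inequality, no asymptotics).
* **`AIS.one_add_cvSq_eq_exp`** — for a weight whose logarithm is Gaussian `N(m, σ²)`,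
  `1 + Var w/(E w)² = exp σ²` (the "factor `exp(σ²)`" by which the sample size is reduced; from
  `LogNormalWeight.cvSq_weight`).
* `AIS.cost σ₀² n := n · exp(σ₀²/n)` (time for a given accuracy) and **`AIS.le_cost`** —
  `σ₀² · e ≤ n · exp(σ₀²/n)` for all real `n > 0`, **`AIS.cost_eq_iff`** — equality iff `n = σ₀²`,
  **`AIS.isMinOn_cost`** — "minimized when `n = σ₀²`"; **`AIS.variance_at_optimum`** — at `n = σ₀²`
  the equal-spacing log-weight variance `σ₀²/n` is `1`, and **`AIS.cvSq_at_optimum`** — a log-normal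
  weight with log-variance `1` has normalized-weight variance `e - 1`.
Only independence of the update states enters the variance identity (row-normalisation / positivity
of the kernels are what make them simulable); `n` is treated as a positive REAL in the optimisation,
as in the source. Not here: the CLT / asymptotic-normality sentence, the geometric-spacing optimality
remark (Neal 1996 §4.2), the `K`-component dimensional argument (it is `variance_logWeight` again with
`h` a sum of `K` i.i.d. terms), imperfect transitions. (Filed by the pub-qed tropical-track engine
seat E3: this is the published backbone of its AIS cost law «c = s²·B, C = K·s_perf²» — the
perfect-transition dispersion `s_perf² = C/K` and the location `s² = 1` of Neal's optimum; VALUE-FREE.)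
-/

noncomputable section

open MeasureTheory ProbabilityTheory Real Finset
open scoped NNReal

namespace Literature.Probability.ImportanceSampling

namespace AIS

/-! ### The log-weight under perfect transitions and its variance -/

section Variance

variable {Ω : Type*} [MeasurableSpace Ω] {P : Measure Ω} {S : Type*} [MeasurableSpace S] {n : ℕ}

/-- The AIS log-weight along one run: `log w = Σ_j c_j · h(x_j)` with `c_j = β_{j-1} - β_j` and
`h = log f_0 - log f_n` evaluated at the `n` update states. [cite: Neal2001AIS, §4] -/
def logWeight (c : Fin n → ℝ) (h : S → ℝ) (X : Fin n → Ω → S) : Ω → ℝ :=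
  fun ω ↦ ∑ j, c j * h (X j ω)

omit [MeasurableSpace Ω] [MeasurableSpace S] in
/-- The log-weight is the finite sum of the functions `ω ↦ c_j h(X_j ω)`. [cite: Neal2001AIS, §4] -/
theorem logWeight_eq_sum (c : Fin n → ℝ) (h : S → ℝ) (X : Fin n → Ω → S) :
    logWeight c h X = ∑ j, fun ω ↦ c j * h (X j ω) := by
  ext ω
  simp only [logWeight, Finset.sum_apply]

/-- PERFECT TRANSITIONS ⇒ the log-weight variance is the sum of the per-step variances:
if the update states `X_j` are mutually independent and each `h ∘ X_j` is square-integrable, then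
`Var[Σ_j c_j h(X_j)] = Σ_j c_j² · Var[h(X_j)]` (the exact finite-`n` form of eq. (eq-aisvar)).
[cite: Neal2001AIS, §4] -/
theorem variance_logWeight [IsProbabilityMeasure P] {X : Fin n → Ω → S} {h : S → ℝ}
    (hX : iIndepFun X P) (hh : Measurable h) (h2 : ∀ j, MemLp (fun ω ↦ h (X j ω)) 2 P)
    (c : Fin n → ℝ) :
    Var[logWeight c h X; P] = ∑ j, c j ^ 2 * Var[fun ω ↦ h (X j ω); P] := by
  rw [logWeight_eq_sum]
  have hind : iIndepFun (fun j ↦ (fun s ↦ c j * h s) ∘ X j) P :=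
    hX.comp (fun j s ↦ c j * h s) fun j ↦ hh.const_mul (c j)
  rw [IndepFun.variance_sum (s := univ)]
  · refine Finset.sum_congr rfl fun j _ ↦ ?_
    exact variance_const_mul (c j) (fun ω ↦ h (X j ω)) P
  · intro j _
    exact (h2 j).const_mul (c j)
  · intro i _ j _ hij
    exact hind.indepFun hij

/-- The same identity written with the annealing LAWS: if moreover `X_j` has law `p_j`
(`P.map (X j) = p j`) and `h ∈ L²(p_j)`, then
`Var[log w] = Σ_j (β_{j-1} - β_j)² · Var_{p_j}[h]`. [cite: Neal2001AIS, §4] -/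
theorem variance_logWeight_eq_sum_laws [IsProbabilityMeasure P] {X : Fin n → Ω → S} {h : S → ℝ}
    {p : Fin n → Measure S} (hX : iIndepFun X P) (hXm : ∀ j, Measurable (X j))
    (hlaw : ∀ j, P.map (X j) = p j) (hh : Measurable h) (h2 : ∀ j, MemLp h 2 (p j))
    (c : Fin n → ℝ) :
    Var[logWeight c h X; P] = ∑ j, c j ^ 2 * Var[h; p j] := by
  have h2' : ∀ j, MemLp (fun ω ↦ h (X j ω)) 2 P := by
    intro j
    have hm : MemLp h 2 (P.map (X j)) := by rw [hlaw j]; exact h2 j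
    exact (memLp_map_measure_iff hm.aestronglyMeasurable (hXm j).aemeasurable).1 hm
  rw [variance_logWeight hX hh h2' c]
  refine Finset.sum_congr rfl fun j _ ↦ ?_
  congr 1
  rw [← hlaw j, variance_map hh.aemeasurable (hXm j).aemeasurable]
  rfl

/-- The MEAN per-step variance `σ₀²(n) := (1/n) Σ_j Var_{p_j}[h]` — the finite-`n` constant in Neal's
"the variance of `log(w^{(i)})` will asymptotically have the form `σ₀²/n`". [cite: Neal2001AIS, §4] -/
def meanStepVariance (h : S → ℝ) (p : Fin n → Measure S) : ℝ :=
  (1 / n) * ∑ j, Var[h; p j]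

omit [MeasurableSpace Ω] in
/-- `σ₀²(n) ≥ 0`. [cite: Neal2001AIS, §4] -/
theorem meanStepVariance_nonneg (h : S → ℝ) (p : Fin n → Measure S) :
    0 ≤ meanStepVariance h p := by
  unfold meanStepVariance
  exact mul_nonneg (by positivity) (Finset.sum_nonneg fun j _ ↦ variance_nonneg _ _)

/-- EQUAL SPACING: with `β_{j-1} - β_j = 1/n` for every `j`,
`Var[log w] = (1/n)² Σ_j Var_{p_j}[h] = σ₀²(n)/n`. [cite: Neal2001AIS, §4] -/
theorem variance_logWeight_equalSpacing [IsProbabilityMeasure P] {X : Fin n → Ω → S} {h : S → ℝ}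
    {p : Fin n → Measure S} (hX : iIndepFun X P) (hXm : ∀ j, Measurable (X j))
    (hlaw : ∀ j, P.map (X j) = p j) (hh : Measurable h) (h2 : ∀ j, MemLp h 2 (p j))
    {c : Fin n → ℝ} (hc : ∀ j, c j = 1 / n) :
    Var[logWeight c h X; P] = meanStepVariance h p / n := by
  rw [variance_logWeight_eq_sum_laws hX hXm hlaw hh h2 c, meanStepVariance]
  simp_rw [hc, ← Finset.mul_sum]
  ring

/-- THE `1/n` LAW AS AN INEQUALITY (no asymptotics): with equal spacing and every per-step variance
`Var_{p_j}[h] ≤ V`, `Var[log w] ≤ V/n`. [cite: Neal2001AIS, §4] -/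
theorem variance_logWeight_le_div [IsProbabilityMeasure P] {X : Fin n → Ω → S} {h : S → ℝ}
    {p : Fin n → Measure S} (hX : iIndepFun X P) (hXm : ∀ j, Measurable (X j))
    (hlaw : ∀ j, P.map (X j) = p j) (hh : Measurable h) (h2 : ∀ j, MemLp h 2 (p j))
    {c : Fin n → ℝ} (hc : ∀ j, c j = 1 / n) {V : ℝ} (hV : ∀ j, Var[h; p j] ≤ V) :
    Var[logWeight c h X; P] ≤ V / n := by
  rw [variance_logWeight_equalSpacing hX hXm hlaw hh h2 hc, meanStepVariance]
  rcases Nat.eq_zero_or_pos n with hn | hn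
  · subst hn
    simp
  have hn' : (0 : ℝ) < n := by exact_mod_cast hn
  have hsum : ∑ j, Var[h; p j] ≤ n * V := by
    calc ∑ j, Var[h; p j] ≤ ∑ _j : Fin n, V := Finset.sum_le_sum fun j _ ↦ hV j
      _ = n * V := by simp
  have hmean : 1 / (n : ℝ) * ∑ j, Var[h; p j] ≤ V := by
    rw [one_div, inv_mul_le_iff₀ hn']
    exact hsum
  exact div_le_div_of_nonneg_right hmean hn'.le

end Variance

/-! ### Gaussian log-weights: the factor `exp(σ²)` -/

section Gaussian

variable {Ω : Type*} [MeasurableSpace Ω] {P : Measure Ω} [IsProbabilityMeasure P] {L : Ω → ℝ}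
  {m : ℝ} {v : ℝ≥0}

/-- "If the `log(w^{(i)})` are Gaussian with mean `μ` and variance `σ²`, the sample size will be
effectively reduced by the factor `1 + Var[w/E w] = E[w²]/E[w]² = exp(σ²)`": for `w = e^L` with
`L ∼ N(m, v)`, `1 + Var w/(E w)² = exp v`. [cite: Neal2001AIS, §4] -/
theorem one_add_cvSq_eq_exp (hL : P.map L = gaussianReal m v) :
    1 + Var[fun ω ↦ exp (L ω); P] / (∫ ω, exp (L ω) ∂P) ^ 2 = exp v := by
  rw [LogNormalWeight.cvSq_weight hL]
  ring

/-- At Neal's optimum the log-weight variance is `1`, and then "the variance of the normalized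
importance weights will be `e - 1`": for `w = e^L` with `L ∼ N(m, 1)`, `Var w/(E w)² = e - 1`.
[cite: Neal2001AIS, §4] -/
theorem cvSq_at_optimum (hL : P.map L = gaussianReal m 1) :
    Var[fun ω ↦ exp (L ω); P] / (∫ ω, exp (L ω) ∂P) ^ 2 = exp 1 - 1 := by
  rw [LogNormalWeight.cvSq_weight hL]
  norm_num

end Gaussian

/-! ### The cost `n · exp(σ₀²/n)` and its minimum at `n = σ₀²` -/

section Cost

/-- Neal's cost of an AIS estimate of a given accuracy when each of the `n` transitions takes a fixed
time and the log-weight variance is `σ₀²/n`: `n · (1 + Var of the normalized weights) = n · exp(σ₀²/n)`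
(`n` a positive real). [cite: Neal2001AIS, §4] -/
def cost (σ₀sq n : ℝ) : ℝ := n * exp (σ₀sq / n)

/-- The value at `n = σ₀²`: `cost σ₀² σ₀² = σ₀² · e`. [cite: Neal2001AIS, §4] -/
theorem cost_self {σ₀sq : ℝ} (hσ : σ₀sq ≠ 0) : cost σ₀sq σ₀sq = σ₀sq * exp 1 := by
  simp [cost, div_self hσ]

/-- THE LOWER BOUND: for every real `n > 0`, `σ₀² · e ≤ n · exp(σ₀²/n)` (from `1 + x ≤ eˣ` at
`x = σ₀²/n - 1`); no sign assumption on `σ₀²` is needed. [cite: Neal2001AIS, §4] -/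
theorem le_cost (σ₀sq : ℝ) {n : ℝ} (hn : 0 < n) : σ₀sq * exp 1 ≤ cost σ₀sq n := by
  have key : σ₀sq / n ≤ exp (σ₀sq / n - 1) := by
    have := add_one_le_exp (σ₀sq / n - 1)
    linarith
  have hexp : exp (σ₀sq / n) = exp 1 * exp (σ₀sq / n - 1) := by
    rw [← exp_add]
    congr 1
    ring
  unfold cost
  rw [hexp]
  calc σ₀sq * exp 1 = n * (exp 1 * (σ₀sq / n)) := by field_simp
    _ ≤ n * (exp 1 * exp (σ₀sq / n - 1)) := by gcongr

/-- "Minimized when `n = σ₀²`": the bound is attained only there — for `n > 0`,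
`n · exp(σ₀²/n) = σ₀² · e ↔ n = σ₀²` (strictness of `1 + x < eˣ` for `x ≠ 0`). [cite: Neal2001AIS, §4] -/
theorem cost_eq_iff {σ₀sq n : ℝ} (hn : 0 < n) : cost σ₀sq n = σ₀sq * exp 1 ↔ n = σ₀sq := by
  constructor
  · intro h
    by_contra hne
    have hx : σ₀sq / n - 1 ≠ 0 := by
      intro h0
      apply hne
      have : σ₀sq / n = 1 := by linarith
      field_simp at this
      linarith
    have key : σ₀sq / n < exp (σ₀sq / n - 1) := by
      have := add_one_lt_exp hx
      linarith
    have hexp : exp (σ₀sq / n) = exp 1 * exp (σ₀sq / n - 1) := by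
      rw [← exp_add]
      congr 1
      ring
    have hlt : σ₀sq * exp 1 < cost σ₀sq n := by
      unfold cost
      rw [hexp]
      calc σ₀sq * exp 1 = n * (exp 1 * (σ₀sq / n)) := by field_simp
        _ < n * (exp 1 * exp (σ₀sq / n - 1)) := by gcongr
    exact absurd h hlt.ne'
  · rintro rfl
    exact cost_self hn.ne'

/-- `n = σ₀²` minimises the cost over all positive real `n` (for `σ₀² > 0`, so that the minimiser is
admissible). [cite: Neal2001AIS, §4] -/
theorem isMinOn_cost {σ₀sq : ℝ} (hσ : 0 < σ₀sq) : IsMinOn (cost σ₀sq) (Set.Ioi 0) σ₀sq := by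
  intro n hn
  rw [Set.mem_setOf_eq, cost_self hσ.ne']
  exact le_cost σ₀sq hn

/-- "At which point the variance of the logs of the importance weights will be one": the
equal-spacing variance `σ₀²/n` at `n = σ₀² ≠ 0` equals `1`. [cite: Neal2001AIS, §4] -/
theorem variance_at_optimum {σ₀sq : ℝ} (hσ : σ₀sq ≠ 0) : σ₀sq / σ₀sq = 1 := div_self hσ

/-- The minimum value re-read: at the optimum the cost per unit `σ₀²` is `e`, i.e.
`cost σ₀² σ₀² / σ₀² = exp 1` — one plus the normalized-weight variance `e - 1` of `cvSq_at_optimum`.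
[cite: Neal2001AIS, §4] -/
theorem cost_self_div {σ₀sq : ℝ} (hσ : σ₀sq ≠ 0) : cost σ₀sq σ₀sq / σ₀sq = exp 1 := by
  rw [cost_self hσ]
  field_simp

end Cost

end AIS

end Literature.Probability.ImportanceSampling
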